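import Summits.QuantumAdvantage.QuantumAdvantage.Theorems.NearExactIsExact.Negative.TypeOOneTwentyOnePrepFourteen

/-!
# Partner costs at six frequencies of size `≥ 6144` — boundary versions (NearExactIsExact, disprover gen 25)

Negative/structural lemmas for the crux `CubicForrelation.NearExactIsExact` (item r2), finite slice `n = 14`; the non-strict
(`≥ 6144`, budget `≤`) versions of `to_partner_typeO` / `to_partner_levelSix` of `…Negative.TypeOOneTwentyOnePrepFourteen`, used by
`…Negative.TypeOBoundaryOneTwentyOneFourteen` (the shape of a type-O side AT `Φ = 121/128`).
HONEST FRAMING: statements about cubic Boolean functions on 14 bits — NOT summit progress; no violation of `NearExactIsExact`.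

With `W_g = 32u` and residual `F = u − 4(−1)^f`, if `|F̂| ≥ 6144` at the six points of `S`:
* `tb_partner_typeO`: a type-O partner (`W_f = 32v`, `v` odd) has `F̂ = −128(v − 4(−1)^g)`, so `|v − 4(−1)^g| ≥ 48`, hence (odd)
  `≥ 49` on `S`: `Σ (v − 4(−1)^g)² ≥ 2¹⁴ + 6·2400 = 30784 > 28672`;
* `tb_partner_levelSix`: a level-6 partner (`W_f = 64v'`, some `v'` odd, `f` cubic) has `F̂ = −256 e`, `e = v' − 2(−1)^g`, so `|e| ≥ 24`
  on `S` (`≥ 25` where `v'` is odd): `Σ e² ≥ #{v' odd} + 6·575 ≥ 2¹² + 3450 = 7546 > 7168`.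

Sources: [this work].  Standard axioms only.
-/

set_option linter.dupNamespace false -- D-0017: single-problem summit ⇒ `QuantumAdvantage.QuantumAdvantage` by design

noncomputable section

namespace Summit.QuantumAdvantage.QuantumAdvantage.Theorems.NearExactIsExact.Negative.TypeOBoundaryPrepFourteen

open Finset
open Literature.Computability.QuantumComplexity
open Literature.Computability.QuantumComplexity.BuzetChailloux (bxor zeroVec bxor_bxor_cancel_left bxor_zeroVec zeroVec_bxor
  bxor_comm bxor_self signOf_sq)
open Literature.Computability.QuantumComplexity.DerivativeWalsh (W dwt sum_W_sq twist_bxor_left sum_char_subspace W_mul_W_bxor)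
open Summit.QuantumAdvantage.QuantumAdvantage.Theorems.CubicForrelation.NearExactIsExact
open Summit.QuantumAdvantage.QuantumAdvantage.Theorems.SignedCubicForrelationNotPrBPP.Negative.HalfQuad (forrelation_comm)
open Summit.QuantumAdvantage.QuantumAdvantage.Theorems.NearExactIsExact.Negative.TightTypeTFourteen (tt_dual)
open Summit.QuantumAdvantage.QuantumAdvantage.Theorems.NearExactIsExact.Negative.TypeOOneTwentyOnePrepFourteen (to_W_residual)

/-! ### Partner costs at six frequencies of size `≥ 6144` (boundary versions) -/

/-- **Type-O partner, boundary version.**  If `W_g = 32u`, `W_f = 32v` with all `v(y)` odd, and the residual transform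
`F̂ = −128(v − 4(−1)^g)` has modulus `≥ 6144` at the `6` points of `S`, then (`v − 4(−1)^g` odd, so `|·| ≥ 49` there)
`Σ_y (v − 4(−1)^g)² ≥ 2¹⁴ + 6·2400 > 28672`.  NOT summit progress. [this work] -/
theorem tb_partner_typeO (f g : (Fin (7 + 7) → Bool) → Bool)
    (u : (Fin (7 + 7) → Bool) → ℤ) (hu : ∀ x, W (fun y => signOf (g y)) x = (2 : ℝ) ^ 5 * (u x : ℝ))
    (v : (Fin (7 + 7) → Bool) → ℤ) (hv : ∀ y, W (fun x => signOf (f x)) y = (2 : ℝ) ^ 5 * (v y : ℝ))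
    (hoddv : ∀ y, Odd (v y)) (S : Finset (Fin (7 + 7) → Bool)) (hS : #S = 6)
    (hbig : ∀ y ∈ S, (6144 : ℝ) ≤ |W (fun x => ((u x - 4 * sZ (f x) : ℤ) : ℝ)) y|)
    (hB : (∑ y, (v y - 4 * sZ (g y)) ^ 2 : ℤ) ≤ 28672) : False := by
  classical
  have hpt : ∀ y, (if y ∈ S then 2401 else 1 : ℤ) ≤ (v y - 4 * sZ (g y)) ^ 2 := by
    intro y
    split_ifs with hy
    · have h := hbig y hy
      rw [tt_dual f g u hu v hv y, abs_mul] at h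
      norm_num at h
      have h' : (48 : ℝ) ≤ |((v y - 4 * sZ (g y) : ℤ) : ℝ)| := by push_cast; linarith
      have h'' : (48 : ℤ) ≤ |v y - 4 * sZ (g y)| := by exact_mod_cast h'
      have h49 : (49 : ℤ) ≤ |v y - 4 * sZ (g y)| := by
        obtain ⟨k, hk⟩ := hoddv y
        rcases tp_sZ_cases (g y) with hs | hs <;>
          rcases abs_choice (v y - 4 * sZ (g y)) with ha | ha <;> omega
      nlinarith [sq_abs (v y - 4 * sZ (g y)), mul_le_mul h49 h49 (by norm_num) (abs_nonneg _)]
    · have hne : v y - 4 * sZ (g y) ≠ 0 := by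
        obtain ⟨k, hk⟩ := hoddv y
        rcases tp_sZ_cases (g y) with hs | hs <;> omega
      nlinarith [sq_abs (v y - 4 * sZ (g y)), Int.one_le_abs hne, abs_nonneg (v y - 4 * sZ (g y))]
  have hsum := sum_le_sum fun y (_ : y ∈ (univ : Finset (Fin (7 + 7) → Bool))) => hpt y
  have hf : univ.filter (fun y => y ∈ S) = S := by ext y; simp
  have hL : ∑ y, (if y ∈ S then 2401 else 1 : ℤ) = 30784 := by
    have e : ∀ y, (if y ∈ S then 2401 else 1 : ℤ) = 1 + (if y ∈ S then 2400 else 0 : ℤ) := by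
      intro y; split_ifs <;> norm_num
    rw [sum_congr rfl fun y _ => e y, sum_add_distrib, ← sum_filter, hf, sum_const, sum_const, card_univ, hS,
      Fintype.card_fun, Fintype.card_bool, Fintype.card_fin]
    simp only [nsmul_eq_mul]
    norm_num
  rw [hL] at hsum
  linarith

/-- **Level-6 partner, boundary version.**  If `W_g = 32u`, `W_f = 64v'` with some `v'(y)` odd (`f` cubic), and the residual
transform `F̂ = −256(v' − 2(−1)^g)` has modulus `≥ 6144` at the `6` points of `S`, then (`|e| ≥ 24`, and `≥ 25` where `v'` is odd)
`Σ_y (v' − 2(−1)^g)² ≥ #{v' odd} + 6·575 ≥ 2¹² + 3450 > 7168`.  NOT summit progress. [this work] -/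
theorem tb_partner_levelSix (f g : (Fin (7 + 7) → Bool) → Bool) (hf : IsDegLeFun 3 f)
    (u : (Fin (7 + 7) → Bool) → ℤ) (hu : ∀ x, W (fun y => signOf (g y)) x = (2 : ℝ) ^ 5 * (u x : ℝ))
    (v' : (Fin (7 + 7) → Bool) → ℤ) (hv' : ∀ y, W (fun x => signOf (f x)) y = (2 : ℝ) ^ 6 * (v' y : ℝ))
    (hodd : ∃ y, Odd (v' y)) (S : Finset (Fin (7 + 7) → Bool)) (hS : #S = 6)
    (hbig : ∀ y ∈ S, (6144 : ℝ) ≤ |W (fun x => ((u x - 4 * sZ (f x) : ℤ) : ℝ)) y|)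
    (hB : (∑ y, (v' y - 2 * sZ (g y)) ^ 2 : ℤ) ≤ 7168) : False := by
  classical
  have hdeg : IsDegLeFun 2 (fun y => decide (Odd (v' y))) :=
    stub_walshTower stub_axParity (7 + 7) 6 2 f v' hf hv' (by intro k hk hkn; omega)
  have hne : ∃ y, decide (Odd (v' y)) = true := by
    obtain ⟨y, hy⟩ := hodd
    exact ⟨y, decide_eq_true hy⟩
  have hrm : 2 ^ (7 + 7) ≤ 2 ^ 2 * #(univ.filter fun y : Fin (7 + 7) → Bool => decide (Odd (v' y)) = true) :=
    bb_rmWeight_holds (7 + 7) 2 _ hdeg hne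
  have hPge : (4096 : ℤ) ≤ #(univ.filter fun y : Fin (7 + 7) → Bool => decide (Odd (v' y)) = true) := by
    have h14 : (2 : ℕ) ^ (7 + 7) = 16384 := by norm_num
    have h2 : (2 : ℕ) ^ 2 = 4 := by norm_num
    rw [h14, h2] at hrm
    omega
  have hWF : ∀ y, W (fun x => ((u x - 4 * sZ (f x) : ℤ) : ℝ)) y = -256 * ((v' y - 2 * sZ (g y) : ℤ) : ℝ) := by
    intro y
    rw [to_W_residual f g u hu y, hv' y]
    push_cast
    rw [← tp_sZ_cast (g y)]
    ring
  have hpt : ∀ y, (if decide (Odd (v' y)) = true then 1 else 0 : ℤ) + (if y ∈ S then 575 else 0 : ℤ) ≤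
      (v' y - 2 * sZ (g y)) ^ 2 := by
    intro y
    by_cases hy : y ∈ S
    · rw [if_pos hy]
      have h := hbig y hy
      rw [hWF y, abs_mul] at h
      norm_num at h
      have h' : (24 : ℝ) ≤ |((v' y - 2 * sZ (g y) : ℤ) : ℝ)| := by push_cast; linarith
      have h'' : (24 : ℤ) ≤ |v' y - 2 * sZ (g y)| := by exact_mod_cast h'
      have hsq : (576 : ℤ) ≤ (v' y - 2 * sZ (g y)) ^ 2 := by
        nlinarith [sq_abs (v' y - 2 * sZ (g y)), mul_le_mul h'' h'' (by norm_num) (abs_nonneg _)]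
      split_ifs with ho
      · have ho' : Odd (v' y) := of_decide_eq_true ho
        have h25 : (25 : ℤ) ≤ |v' y - 2 * sZ (g y)| := by
          obtain ⟨k, hk⟩ := ho'
          rcases tp_sZ_cases (g y) with hs | hs <;>
            rcases abs_choice (v' y - 2 * sZ (g y)) with ha | ha <;> omega
        nlinarith [sq_abs (v' y - 2 * sZ (g y)), mul_le_mul h25 h25 (by norm_num) (abs_nonneg _)]
      · linarith
    · rw [if_neg hy, add_zero]
      split_ifs with ho
      · have ho' : Odd (v' y) := of_decide_eq_true ho
        have hne' : v' y - 2 * sZ (g y) ≠ 0 := by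
          obtain ⟨k, hk⟩ := ho'
          rcases tp_sZ_cases (g y) with hs | hs <;> omega
        nlinarith [sq_abs (v' y - 2 * sZ (g y)), Int.one_le_abs hne', abs_nonneg (v' y - 2 * sZ (g y))]
      · positivity
  have hsum := sum_le_sum fun y (_ : y ∈ (univ : Finset (Fin (7 + 7) → Bool))) => hpt y
  have hf' : univ.filter (fun y => y ∈ S) = S := by ext y; simp
  have hS575 : ∑ y, (if y ∈ S then 575 else 0 : ℤ) = 3450 := by
    rw [← sum_filter, hf', sum_const, hS]
    simp only [nsmul_eq_mul]
    norm_num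
  rw [sum_add_distrib, sum_boole, hS575] at hsum
  linarith


end Summit.QuantumAdvantage.QuantumAdvantage.Theorems.NearExactIsExact.Negative.TypeOBoundaryPrepFourteen

end
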